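import Summits.Ventures.Crystal3D.Theorems.StickyWulffConstantCoaxialWallLawBarlowWindowTwinReadings
import Summits.Ventures.Crystal3D.Theorems.StickyWulffConstantCoaxialWallLawEndRowOuterShellSig
import Summits.Ventures.Crystal3D.Theorems.StickyWulffConstantCoaxialWallLawBarlowTailDefs
import Summits.Ventures.Crystal3D.Theorems.StickyWulffConstantCoaxialWallLawOnSiteCapstone
import HarnessLib

/-!
# THE FLAT BRIDGE: the inner-universe certificate bounds EVERY Barlow payer window; the crux from it and the NON-BARLOW tails
# (crux `CoaxialWallLaw`, stmt-Ventures-19481, line `WallLedgerF`)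

HONEST FRAMING. Venture `Summits/Ventures/Crystal3D` (cell `crystal3d-full`), helper `--supports` the crux
`CoaxialWallLaw` (stmt-Ventures-19481, `route-Ventures-StickyWulffConstant`), REGISTERED line `WallLedgerF` (planner
cf-p1).  Rung credit; F-C1 not moved; CONDITIONAL on the named facts it consumes (census-free apart from the final
computational-grade capstone, which imports `…TwoRowsCertifiedA`'s certified kissing facts).  cf-p1 DECISION (xlviii)
and 23:05:35Z «LANE-F CHAIN OF RECORD at the signature level»:
`localSummandA ≤ localStatSig P Σ` (`…OnSiteBridge`, any vacancy set) `≤ localStatSigFlat P♯ Σ` (19481-p1's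
`localStatSig_le_localStatSigFlat`, `…EndRowOuterShellSig`; `P♯` = the window with its outer shell `2 < |x| ≤ 3` FILLED,
a pattern of `barlowInnerUniverse`; the far-slot hypothesis discharged by `far_slot_not_site_barlow`,
`…BarlowWindowTwinReadings`) `≤ s_F` (the certificate `EndRowOnSiteFlatA v s_F barlowInnerUniverse`).

* **`endRowOnSiteA_window_of_flat_inner`** : `EndRowOnSiteFlatA v s_F barlowInnerUniverse → EndRowOnSiteA v s_F
  (barlowWindowUniverse n)` for EVERY `n` — the Barlow part of the old tail («≥ 5 vacancies») is gone;
* `localSummandA_trans_le_of_onSiteFlatA`, `localSummandA_twin_le_of_onSiteFlatA` — at every payer window on ANY Barlow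
  stacking (`OnSiteAt barlowWindowUniverseAll`), every frame, the typed summand is `≤ s_F`;
* **`endRowTransA_of_onSiteFlatA`**, **`endRowTwinHalfTurnA_of_onSiteFlatA`** :
  `EndRowOnSiteFlatA v s_F barlowInnerUniverse → EndRow…TailA v s_F barlowWindowUniverseAll → EndRow…A v s_F` — the tail
  hypothesis now literally reads «payer windows NOT on any Barlow stacking» (the NON-BARLOW tail, 19481-p1's U-R);
* **`coaxialWallLaw_of_onSiteFlatA_v2A_nineHalves`** : `P5Exhaustion → EndRowOnSiteFlatA v2 (9/2) barlowInnerUniverse →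
  EndRowTwinTailA v2 (9/2) barlowWindowUniverseAll → EndRowTransTailA v2 (9/2) barlowWindowUniverseAll → CoaxialWallLaw`
  (computational grade), and the generic `coaxialWallLaw_of_onSiteFlatA_certified`.
LANE F's BY-NAME DEBTS after this file: {`P5Exhaustion` (E1), `EndRowOnSiteFlatA v2 (9/2) barlowInnerUniverse` (the B&B
certificate of PREREG-F-CERT §13: lit j320000/j320082, all nodes pruned at 4.40 on the pilot word), the two NON-BARLOW
tails}.
WHAT THIS IS NOT: none of the three hypotheses is proved here; F-C1 not moved.
-/

noncomputable section

namespace Summit.Ventures.Crystal3D.Theorems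

open Summit.Ventures.Crystal3D Finset
open Literature.MathematicalPhysics.StatisticalMechanics (barlowStacking IsHaggSeq)
open scoped InnerProductSpace

/-! ### Filling the outer shell: every Barlow payer window is bounded by the inner-universe certificate -/

open scoped Classical in
/-- **THE INNER REDUCTION.**  The flat on-site fact over `barlowInnerUniverse` implies the on-site fact over U-W(`n`) for
EVERY `n`: fill the outer-shell vacancies (outer-shell reduction on the signature rows; its far-slot hypothesis holds on
Barlow windows by `far_slot_not_site_barlow`). -/
theorem endRowOnSiteA_window_of_flat_inner {v : WordVersion} {sF : ℝ} (hon : EndRowOnSiteFlatA v sF barlowInnerUniverse)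
    (n : ℕ) : EndRowOnSiteA v sF (barlowWindowUniverse n) := by
  intro P hP
  obtain ⟨s, hs, V, -, hVs, hPeq, h0, hdeg⟩ := hP
  -- the pattern with its outer shell filled
  set A : Finset (EuclideanSpace ℝ (Fin 3)) :=
    V.filter fun x => 2 < dist (0 : EuclideanSpace ℝ (Fin 3)) x ∧ dist x (0 : EuclideanSpace ℝ (Fin 3)) ≤ 3 with hA
  set P' : Finset (EuclideanSpace ℝ (Fin 3)) := P ∪ A with hP'
  have hPmem : ∀ x, x ∈ P ↔ x ∈ barlowStacking 1 (Real.sqrt (2 / 3)) s ∧ dist x (0 : EuclideanSpace ℝ (Fin 3)) ≤ 3 ∧ x ∉ V := by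
    intro x
    have := Set.ext_iff.1 hPeq x
    simp only [mem_coe, Set.mem_sdiff, Set.mem_inter_iff, Metric.mem_closedBall] at this
    rw [this]; tauto
  have hPΛ : ∀ x ∈ P, x ∈ barlowStacking 1 (Real.sqrt (2 / 3)) s := fun x hx => ((hPmem x).1 hx).1
  have hP'Λ : ∀ x ∈ P', x ∈ barlowStacking 1 (Real.sqrt (2 / 3)) s := by
    intro x hx
    rcases mem_union.1 hx with hx | hx
    · exact hPΛ x hx
    · exact hVs (mem_coe.2 (mem_filter.1 hx).1)
  have hin : ∀ x ∈ P', dist (0 : EuclideanSpace ℝ (Fin 3)) x ≤ 2 → x ∈ P := by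
    intro x hx hd
    rcases mem_union.1 hx with hx | hx
    · exact hx
    · exact absurd hd (not_le.2 (mem_filter.1 hx).2.1)
  -- `P'` is an inner pattern
  have hP'in : P' ∈ barlowInnerUniverse := by
    refine ⟨s, hs, V.filter (fun x => dist x (0 : EuclideanSpace ℝ (Fin 3)) ≤ 2), ?_, ?_, mem_union_left _ h0, ?_⟩
    · intro x hx
      rw [mem_coe, mem_filter] at hx
      exact ⟨hVs (mem_coe.2 hx.1), Metric.mem_closedBall.2 hx.2⟩
    · ext x
      simp only [hP', hA, mem_coe, mem_union, mem_filter, Set.mem_sdiff, Set.mem_inter_iff, Metric.mem_closedBall, hPmem]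
      constructor
      · rintro (⟨hΛ, hd, hV⟩ | ⟨hV, hd2, hd3⟩)
        · exact ⟨⟨hΛ, hd⟩, fun h => hV h.1⟩
        · refine ⟨⟨hVs (mem_coe.2 hV), hd3⟩, fun h => ?_⟩
          rw [dist_comm] at hd2; linarith [h.2]
      · rintro ⟨⟨hΛ, hd⟩, hnot⟩
        by_cases hV : x ∈ V
        · right
          refine ⟨hV, ?_, hd⟩
          rw [dist_comm]; exact not_le.1 fun h => hnot ⟨hV, h⟩
        · exact Or.inl ⟨hΛ, hd, hV⟩
    · have : P'.filter (fun q => dist (0 : EuclideanSpace ℝ (Fin 3)) q = 1) =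
          P.filter (fun q => dist (0 : EuclideanSpace ℝ (Fin 3)) q = 1) := by
        ext q
        simp only [mem_filter]
        constructor
        · rintro ⟨hq, hd⟩; exact ⟨hin q hq (by linarith), hd⟩
        · rintro ⟨hq, hd⟩; exact ⟨mem_union_left _ hq, hd⟩
      rw [this]; exact hdeg
  -- the far-slot hypothesis on the Barlow window `P`
  have hfar : ∀ q ∈ P, dist (0 : EuclideanSpace ℝ (Fin 3)) q ≤ 2 →
      ∀ (G : EuclideanSpace ℝ (Fin 3) ≃ₗᵢ[ℝ] EuclideanSpace ℝ (Fin 3)) (m : EuclideanSpace ℝ (Fin 3)),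
      IsTwinReading P G m q → ∀ w ∈ fccSlots, 0 < ⟪G w, m⟫_ℝ → q + G w ∉ P' := by
    intro q hq _ G m htr w hw hpos hmem
    exact far_slot_not_site_barlow hs (hPΛ q hq) (fun x hx _ => hPΛ x hx) htr hw hpos (hP'Λ _ hmem)
  obtain ⟨hT, hW⟩ := hon P' hP'in
  refine ⟨fun ε n' hn' => le_trans ?_ (hT ε n' hn'), fun ε h hh => le_trans ?_ (hW ε h hh)⟩
  · exact localStatSig_le_localStatSigFlat (fun σ hσ => norm_eq_one_of_mem_transSigs hσ) subset_union_left hin h0 hdeg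
      hfar
  · exact localStatSig_le_localStatSigFlat (fun σ hσ => norm_eq_one_of_mem_twinSigs hσ) subset_union_left hin h0 hdeg
      hfar

/-! ### The flat bridge and the NON-BARLOW tails -/

section Bridge

variable {v : WordVersion} {sF : ℝ} (hon : EndRowOnSiteFlatA v sF barlowInnerUniverse)
include hon

open scoped Classical in
/-- **Flat bridge, translation row**: at every payer window on ANY Barlow stacking, every frame, the summand is `≤ s_F`. -/
theorem localSummandA_trans_le_of_onSiteFlatA (L : EuclideanSpace ℝ (Fin 3) ≃ₗᵢ[ℝ] EuclideanSpace ℝ (Fin 3))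
    {X : Finset (EuclideanSpace ℝ (Fin 3))} {z : EuclideanSpace ℝ (Fin 3)} (hsite : OnSiteAt barlowWindowUniverseAll X z) :
    localSummandA v ⟨L, inPlaneRoots L 1⟩ ⟨L, inPlaneRoots L (-1)⟩ X z ≤ sF := by
  obtain ⟨P, hP, S, hwin⟩ := hsite
  obtain ⟨n, hPn⟩ := Set.mem_iUnion.1 hP
  exact localSummandA_trans_le_of_onSiteA (fun _ h => isBarlowWindow_of_mem_barlowWindowUniverse h)
    (endRowOnSiteA_window_of_flat_inner hon n) L ⟨P, hPn, S, hwin⟩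

open scoped Classical in
/-- **Flat bridge, twin row** (half-turn form). -/
theorem localSummandA_twin_le_of_onSiteFlatA (L : EuclideanSpace ℝ (Fin 3) ≃ₗᵢ[ℝ] EuclideanSpace ℝ (Fin 3))
    {X : Finset (EuclideanSpace ℝ (Fin 3))} {z : EuclideanSpace ℝ (Fin 3)} (hsite : OnSiteAt barlowWindowUniverseAll X z) :
    localSummandA v ⟨L, inPlaneRoots L 1⟩
      ⟨((ℝ ∙ EuclideanSpace.single (2 : Fin 3) (1 : ℝ)).reflection).trans L,
        inPlaneRoots (((ℝ ∙ EuclideanSpace.single (2 : Fin 3) (1 : ℝ)).reflection).trans L) (-1)⟩ X z ≤ sF := by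
  obtain ⟨P, hP, S, hwin⟩ := hsite
  obtain ⟨n, hPn⟩ := Set.mem_iUnion.1 hP
  exact localSummandA_twin_le_of_onSiteA (fun _ h => isBarlowWindow_of_mem_barlowWindowUniverse h)
    (endRowOnSiteA_window_of_flat_inner hon n) L ⟨P, hPn, S, hwin⟩

/-- **`EndRowTransA` from the inner-universe flat certificate and the NON-BARLOW translation tail.** -/
theorem endRowTransA_of_onSiteFlatA (htail : EndRowTransTailA v sF barlowWindowUniverseAll) : EndRowTransA v sF :=
  endRowTransA_of_onSite_of_tail barlowWindowUniverseAll
    (fun L _ _ _ _ _ hsite => localSummandA_trans_le_of_onSiteFlatA hon L hsite) htail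

/-- **`EndRowTwinHalfTurnA` from the inner-universe flat certificate and the NON-BARLOW twin tail.** -/
theorem endRowTwinHalfTurnA_of_onSiteFlatA (htail : EndRowTwinTailA v sF barlowWindowUniverseAll) :
    EndRowTwinHalfTurnA v sF :=
  endRowTwinHalfTurnA_of_onSite_of_tail barlowWindowUniverseAll
    (fun L _ _ _ _ _ hsite => localSummandA_twin_le_of_onSiteFlatA hon L hsite) htail

end Bridge

/-! ### The capstone -/

/-- **The crux from `P5Exhaustion`, the inner-universe flat certificate and the two non-Barlow tails**, any version and
constant `0 < s_F ≤ 2√6`, kissing facts certified. -/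
theorem coaxialWallLaw_of_onSiteFlatA_certified (ver : WordVersion) (hE1 : P5Exhaustion) {sF : ℝ} (hsF : 0 < sF)
    (hsF' : sF ≤ 2 * Real.sqrt 6) (hon : EndRowOnSiteFlatA ver sF barlowInnerUniverse)
    (htailW : EndRowTwinTailA ver sF barlowWindowUniverseAll) (htailT : EndRowTransTailA ver sF barlowWindowUniverseAll) :
    Summit.Ventures.Crystal3D.Theses.StickyWulffConstant.CoaxialWallLaw :=
  coaxialWallLaw_of_twoRowsA_certified ver hE1 hsF hsF' (endRowTwinHalfTurnA_of_onSiteFlatA hon htailW)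
    (endRowTransA_of_onSiteFlatA hon htailT)

/-- **THE LANE-F CAPSTONE OF RECORD (cf-p1 (xlviii), chain at the signature level): `(v2(A), r = 1)`, `s_F* = 9/2`,
certificate universe U-IN, tails = non-Barlow payer windows.** -/
theorem coaxialWallLaw_of_onSiteFlatA_v2A_nineHalves (hE1 : P5Exhaustion)
    (hon : EndRowOnSiteFlatA WordVersion.v2 (9 / 2) barlowInnerUniverse)
    (htailW : EndRowTwinTailA WordVersion.v2 (9 / 2) barlowWindowUniverseAll)
    (htailT : EndRowTransTailA WordVersion.v2 (9 / 2) barlowWindowUniverseAll) :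
    Summit.Ventures.Crystal3D.Theses.StickyWulffConstant.CoaxialWallLaw :=
  coaxialWallLaw_of_onSiteFlatA_certified WordVersion.v2 hE1 (by norm_num) nine_halves_le_two_sqrt_six hon htailW htailT

end Summit.Ventures.Crystal3D.Theorems

end
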